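/-
Copyright: cell `pub-ymgap` (HUMAN RULING D-0062), Track A of `YM-PLAN.md`, DAG node N20 (= NE7b); R134 acceleration seat
`pub-ymgap-dag-n20-c` (strategy s1, generation 3), module 11a.  Released under the licence of the surrounding project.
-/
import Summits.QuantumFields.YangMills.Theorems.BalabanUVNodesN20LCSRestrictedRPCauchySchwarz
import Literature.Probability.LatticeModels.ChessboardEstimateEvenTorus
import HarnessLib

/-!
# YM-DAG node N20 (= NE7b), strategy s1, module 11a: THE CHESSBOARD ESTIMATE FOR THE PLAQUETTE-WEIGHTED (SMALL-FIELD-RESTRICTED)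
# LEVEL-0 STATE OF RECORD — site reflections in EVERY axis and EVERY lattice hyperplane, for any reflection-covariant family of
# cube-indexed non-negative observables (located residual (ii)(b) of the seat's triage: the chessboard ITERATION)

Track A of `YM-PLAN.md` (cell `pub-ymgap`, HUMAN RULING D-0062), node **N20** = spine estimate NE7b (`T4WeightBudget.RelWeightBound` — the
cell `pub-balaban`'s OWN estimate, NOT PRINTED in [Bałaban 1983–89], NOT PROVED).  Seat `pub-ymgap-dag-n20-c` (R134, s1), module 11a
(modules 8∕9: `…Theorems.BalabanUVNodesN20LCSRestrictedRP{,CauchySchwarz}` — reflection positivity and reflection Cauchy–Schwarz of the weighted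
level-0 state for the TIME site reflection; module 10a–c: the restricted uniform doubling).  Kernel theorems only: 0 `def`, 0 `sorry`, standard
axioms; COUNT-NEUTRAL; `--supports` the K3′ item `SpineGivenEndpointR12` (stmt-QuantumFields-19908) as a helper.  Nothing of Bałaban's is asserted:
the objects are the cell's `Missing.expect`, `GaugeField.negReflect ∕ translate ∕ permute`, `PosHalfSupported` and the tree's abstract block
chessboard vocabulary `BlockIdx ∕ cellReflect ∕ halfPlus ∕ symP ∕ symM` (`Barriers.CriticalPhenomena.PositionSpaceRGNonGibbsianChessboard`),
read BY NAME.

WHY.  Located residual (ii)(b) of the seat's `N20-S1-TRIAGE.md` §1: «LCS-j» in the history term's own (small-field-RESTRICTED) state needs a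
chessboard estimate for the weighted state `∏_p w(1 − Re tr U(∂p))·e^{−βA}`, and the only reflections that survive an all-plaquette
restriction are the SITE reflections (module 8).  The tree's chessboards for the Wilson measure (`PlaquetteProductRPCS.rpcs_link`,
`WilsonPlaquetteChessboardEvenSide`, `FdVOC22MultiReflectionBound`) iterate LINK reflections transversally (one plaquette per cell); the way
out typed here: index observables by the CLOSED UNIT CUBES `[c, c+1]^d` (lower corners `c` = the block torus `(ℤ∕N₀)^d` of the abstract
chessboard), on which the site reflection in the hyperplane `x_μ = k` acts as the block reflection `cellReflect μ k : c ↦ c[μ ↦ 2k − 1 − c_μ]`,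
and obtain the reflection Cauchy–Schwarz inequality in EVERY axis by transporting module 9's time-axis inequality along the exact symmetries
`permute (swap 0 μ)` and `translate` of the torus expectation.

WHAT IS PROVED ([folklore]: Osterwalder–Seiler ∕ Fröhlich–Israel–Lieb–Simon bookkeeping on a finite torus):
* §1 `translate_neg_translate`, `conj_left_inv`, `conj_right_inv`, ★ **`expect_conj_pairing_sq_le`** — reflection Cauchy–Schwarz
  `⟨(A∘R)·B·∏w⟩² ≤ ⟨(A∘R)·A·∏w⟩·⟨(B∘R)·B·∏w⟩` for EVERY conjugate site reflection `R U = τ_a(π·Θ'(π⁻¹·τ_{−a}U))`, for `A`, `B` whose pull-backs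
  along `σ' = τ_a ∘ π` are positive-half supported (module 9's `expect_negReflect_pairing_sq_le` + `Missing.expect_permute ∕ expect_translate`).
* §2 `conjLabel_eq_cellReflect` (for `π = swap 0 μ`, `a = −k e_μ` the label action of `R` on cubes is `cellReflect μ k`), `conjLabel_time`,
  `posHalfSupported_finsetProd`, `expect_mul_prod_nonneg`, ★★ **`chessboard_of_covariant`** — for `β ≥ 0`, a non-negative bounded measurable
  weight `w` with `⟨∏w⟩ > 0`, and ANY family `F : (ℤ∕N₀)^d → observables` of non-negative bounded measurable observables covariant under
  translations, coordinate permutations and `Θ'` (label actions `c ↦ c + a`, `c ↦ π·c`, `c ↦ c[0 ↦ −1 − c₀]`), positive-half supported at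
  time-positive cubes, with `⟨∏_c F_c ∏w⟩ > 0`:
  `⟨∏_{c∈S} F_c ∏w⟩∕⟨∏w⟩ ≤ (⟨∏_c F_c ∏w⟩∕⟨∏w⟩)^{#S∕N₀^d}` for every `S` — the tree's `Probability.LatticeModels.chessboard_le_rpow_even`
  (FILS Thm. 4.1 ∕ Friedli–Velenik Thm. 10.11 on every even torus) fed with §1.
Module 11b instantiates `F` with the CUBE ENERGIES `E_c = Σ_{p ⊂ [c,c+1]^d} (1 − Re tr U(∂p))` (`F_c = e^{tE_c}`).

HONEST FRAMING.  A chessboard estimate for the bare Wilson weight dressed by a reflection-symmetric product of one-plaquette weights, on one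
finite torus `T^{(0)}` of Bałaban's `Params`, `SU(N)`; nothing at levels `≥ 1`, no restricted DOUBLING here (module 10c), no junction to the
history terms (later module), residual (i) (domination letter, seat n20-d) and (iv) (A1c) untouched.  NE7b NOT PRINTED ∕ NOT PROVED; (α)-instance
0∕1; N20 NOT discharged; typed 28∕28, discharged count untouched; NOT ℝ⁴, NOT infinite volume, NOT OS axioms, NOT a mass gap, NOT Clay.
-/

set_option autoImplicit false

noncomputable section

namespace Summit.QuantumFields.YangMills.BalabanUVNodes.N20LCSRestrictedChessboard

open MeasureTheory Finset
open Literature.MathematicalPhysics.QuantumFieldTheory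
open Literature.MathematicalPhysics.QuantumFieldTheory.Balaban1983to89
open Literature.Barriers.CriticalPhenomena.NonGibbs
open Literature.Probability.LatticeModels (chessboard_le_rpow_even)
open Summit.QuantumFields.YangMills.BalabanUVNodes.N20LCSRestrictedRP (prod_plaqWeight_permute)
open Summit.QuantumFields.YangMills.BalabanUVNodes.N20LCSRestrictedRPCauchySchwarz (expect_negReflect_pairing_sq_le
  prod_plaqWeight_translate translate_translate_neg)

variable {N : ℕ} [NeZero N]

/-! ## §1 Reflection Cauchy–Schwarz for the CONJUGATE site reflections `σ' ∘ Θ' ∘ σ` (`σ'` = permute-then-translate) -/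

section Conjugate

omit [NeZero N] in
/-- `τ_a ∘ τ_{−a} = id` on configurations. [folklore] -/
theorem translate_neg_translate (P : Params) (a : Balaban1983to89.Site P 0) (V : GaugeField P 0 (Matrix.specialUnitaryGroup (Fin N) ℂ)) :
    (V.translate (-a)).translate a = V := by
  have h := translate_translate_neg (N := N) P (-a) V
  rwa [neg_neg] at h

omit [NeZero N] in
/-- The conjugating symmetry `σ' V = τ_a(π·V)` undoes `σ U = π⁻¹·(τ_{−a} U)`. [folklore] -/
theorem conj_left_inv (P : Params) (π : Equiv.Perm (Fin P.d)) (a : Balaban1983to89.Site P 0)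
    (U : GaugeField P 0 (Matrix.specialUnitaryGroup (Fin N) ℂ)) :
    (((U.translate (-a)).permute π⁻¹).permute π).translate a = U := by
  rw [GaugeField.permute_permute, inv_mul_cancel, GaugeField.permute_one, translate_neg_translate]

omit [NeZero N] in
/-- `σ (σ' V) = V`. [folklore] -/
theorem conj_right_inv (P : Params) (π : Equiv.Perm (Fin P.d)) (a : Balaban1983to89.Site P 0)
    (V : GaugeField P 0 (Matrix.specialUnitaryGroup (Fin N) ℂ)) :
    (((V.permute π).translate a).translate (-a)).permute π⁻¹ = V := by
  rw [translate_translate_neg, GaugeField.permute_permute, mul_inv_cancel, GaugeField.permute_one]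

/-- **REFLECTION CAUCHY–SCHWARZ FOR EVERY CONJUGATE SITE REFLECTION.**  For a coordinate permutation `π` and a lattice vector `a` let
`R U := τ_a(π·Θ'(π⁻¹·τ_{−a}U))` — in the pull-back conventions of `GaugeField.permute`∕`GaugeField.translate`:
`R U = ((((U.translate (−a)).permute π⁻¹).negReflect).permute π).translate a`; for `π = swap 0 μ`, `a = −k e_μ` this is the
Osterwalder–Seiler site reflection of the axis `μ` in the hyperplanes `x_μ = k`, `x_μ = k + N₀∕2`.  Then for `β ≥ 0`, a non-negative bounded
measurable one-plaquette weight `w` and bounded measurable real `A`, `B` whose pull-backs `A ∘ σ'`, `B ∘ σ'` along `σ' V = τ_a(π·V)` are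
supported in the closed positive-TIME half:
`⟨(A∘R)·B·∏_p w⟩² ≤ ⟨(A∘R)·A·∏_p w⟩ · ⟨(B∘R)·B·∏_p w⟩` — module 9's `expect_negReflect_pairing_sq_le` transported along the exact symmetry
`σ'` (`Missing.expect_permute`, `Missing.expect_translate`; the weight is invariant, `prod_plaqWeight_permute`∕`_translate`). [folklore] -/
theorem expect_conj_pairing_sq_le (P : Params) {β : ℝ} (hβ : 0 ≤ β) (π : Equiv.Perm (Fin P.d)) (a : Balaban1983to89.Site P 0)
    {w : ℝ → ℝ} (hw0 : ∀ t, 0 ≤ w t) (hwm : Measurable w) (hwb : ∃ K : ℝ, ∀ t, w t ≤ K)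
    {A B : GaugeField P 0 (Matrix.specialUnitaryGroup (Fin N) ℂ) → ℝ} (hA : Measurable A) (hAb : ∃ C : ℝ, ∀ U, |A U| ≤ C)
    (hApos : PosHalfSupported fun V => A ((V.permute π).translate a)) (hB : Measurable B) (hBb : ∃ C : ℝ, ∀ U, |B U| ≤ C)
    (hBpos : PosHalfSupported fun V => B ((V.permute π).translate a)) :
    Missing.expect (G := Matrix.specialUnitaryGroup (Fin N) ℂ) P β
        (fun U => A (((((U.translate (-a)).permute π⁻¹).negReflect).permute π).translate a) * B U *
          ∏ p : Plaq P 0, w (1 - reTr (GaugeField.plaqHol U p))) ^ 2 ≤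
      Missing.expect (G := Matrix.specialUnitaryGroup (Fin N) ℂ) P β
          (fun U => A (((((U.translate (-a)).permute π⁻¹).negReflect).permute π).translate a) * A U *
            ∏ p : Plaq P 0, w (1 - reTr (GaugeField.plaqHol U p))) *
        Missing.expect (G := Matrix.specialUnitaryGroup (Fin N) ℂ) P β
          (fun U => B (((((U.translate (-a)).permute π⁻¹).negReflect).permute π).translate a) * B U *
            ∏ p : Plaq P 0, w (1 - reTr (GaugeField.plaqHol U p))) := by
  have hσm : Measurable fun V : GaugeField P 0 (Matrix.specialUnitaryGroup (Fin N) ℂ) => (V.permute π).translate a :=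
    (GaugeField.measurePreserving_translate (G := Matrix.specialUnitaryGroup (Fin N) ℂ) a).measurable.comp
      (GaugeField.measurePreserving_permute (G := Matrix.specialUnitaryGroup (Fin N) ℂ) π).measurable
  have hAσm : Measurable fun V : GaugeField P 0 (Matrix.specialUnitaryGroup (Fin N) ℂ) => A ((V.permute π).translate a) :=
    hA.comp hσm
  have hBσm : Measurable fun V : GaugeField P 0 (Matrix.specialUnitaryGroup (Fin N) ℂ) => B ((V.permute π).translate a) :=
    hB.comp hσm
  have hAσb : ∃ C : ℝ, ∀ V : GaugeField P 0 (Matrix.specialUnitaryGroup (Fin N) ℂ), |A ((V.permute π).translate a)| ≤ C := by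
    obtain ⟨C, hC⟩ := hAb; exact ⟨C, fun V => hC _⟩
  have hBσb : ∃ C : ℝ, ∀ V : GaugeField P 0 (Matrix.specialUnitaryGroup (Fin N) ℂ), |B ((V.permute π).translate a)| ≤ C := by
    obtain ⟨C, hC⟩ := hBb; exact ⟨C, fun V => hC _⟩
  have h := expect_negReflect_pairing_sq_le (N := N) P hβ hw0 hwm hwb hAσm hAσb hApos hBσm hBσb hBpos
  -- transport each pairing along `σ'`
  have key : ∀ (X Y : GaugeField P 0 (Matrix.specialUnitaryGroup (Fin N) ℂ) → ℝ),
      Missing.expect (G := Matrix.specialUnitaryGroup (Fin N) ℂ) P β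
          (fun U => X (((((U.translate (-a)).permute π⁻¹).negReflect).permute π).translate a) * Y U *
            ∏ p : Plaq P 0, w (1 - reTr (GaugeField.plaqHol U p))) =
        Missing.expect (G := Matrix.specialUnitaryGroup (Fin N) ℂ) P β
          (fun V => X (((V.negReflect).permute π).translate a) * Y ((V.permute π).translate a) *
            ∏ p : Plaq P 0, w (1 - reTr (GaugeField.plaqHol V p))) := by
    intro X Y
    rw [← Missing.expect_translate P β a (fun U => X (((((U.translate (-a)).permute π⁻¹).negReflect).permute π).translate a) *
      Y U * ∏ p : Plaq P 0, w (1 - reTr (GaugeField.plaqHol U p))),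
      ← Missing.expect_permute P β π]
    refine congrArg _ (funext fun V => ?_)
    rw [conj_right_inv, prod_plaqWeight_translate, prod_plaqWeight_permute]
  rw [key A B, key A A, key B B]
  exact h

end Conjugate

/-! ## §2 The CHESSBOARD ESTIMATE for the weighted level-0 state and any reflection-covariant family of cube-indexed observables -/

section Chessboard

/-- **THE LABEL ACTION OF THE CONJUGATE REFLECTION IS THE BLOCK REFLECTION.**  With `π = swap 0 μ` and `a = −k e_μ`, the label map
`c ↦ π⁻¹·(θ₀(π·(c + a))) − a` (`θ₀ c = c[0 ↦ −1 − c₀]`, the label action of `Θ'` on unit cubes) is `cellReflect μ k`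
(`c ↦ c[μ ↦ 2k − 1 − c_μ]`) of the tree's abstract chessboard. [folklore] -/
theorem conjLabel_eq_cellReflect (P : Params) (μ : Fin P.d) (k : ZMod (P.sitesPerDir 0)) (c a : BlockIdx P.d (P.sitesPerDir 0))
    (ha : ∀ ν, a ν = if ν = μ then -k else 0) :
    @HAdd.hAdd (BlockIdx P.d (P.sitesPerDir 0)) (BlockIdx P.d (P.sitesPerDir 0)) (BlockIdx P.d (P.sitesPerDir 0)) _
      (Site.permute (Equiv.swap 0 μ)⁻¹ (Function.update (Site.permute (Equiv.swap 0 μ) (c + a)) 0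
        (-1 - (Site.permute (Equiv.swap 0 μ) (c + a)) 0))) (-a) = cellReflect μ k c := by
  funext ν
  rw [cellReflect_apply, Pi.add_apply, Pi.neg_apply, Site.permute_apply, Equiv.Perm.inv_def, Equiv.symm_symm]
  by_cases hν : ν = μ
  · subst hν
    rw [Equiv.swap_apply_right, Function.update_self, Function.update_self, Site.permute_apply, Equiv.symm_swap,
      Equiv.swap_apply_left, Pi.add_apply, ha, if_pos rfl]
    ring
  · rw [Function.update_of_ne hν, ha, if_neg hν, neg_zero, add_zero]
    by_cases h0 : ν = 0
    · subst h0
      rw [Equiv.swap_apply_left, Function.update_of_ne (Ne.symm hν), Site.permute_apply, Equiv.symm_swap,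
        Equiv.swap_apply_right, Pi.add_apply, ha, if_neg hν, add_zero]
    · rw [Equiv.swap_apply_of_ne_of_ne h0 hν, Function.update_of_ne h0, Site.permute_apply, Equiv.symm_swap,
        Equiv.swap_apply_of_ne_of_ne h0 hν, Pi.add_apply, ha, if_neg hν, add_zero]

/-- The time coordinate of the conjugated label `π·(c + a)` is `c_μ − k`. [folklore] -/
theorem conjLabel_time (P : Params) (μ : Fin P.d) (k : ZMod (P.sitesPerDir 0)) (c a : BlockIdx P.d (P.sitesPerDir 0))
    (ha : ∀ ν, a ν = if ν = μ then -k else 0) :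
    (Site.permute (Equiv.swap 0 μ) (c + a)) 0 = c μ - k := by
  rw [Site.permute_apply, Equiv.symm_swap, Equiv.swap_apply_left, Pi.add_apply, ha, if_pos rfl]
  ring

/-- Products of positive-half-supported real observables are positive-half supported. [folklore] -/
theorem posHalfSupported_finsetProd {P : Params} {G : Type*} {ι : Type*} (s : Finset ι) (F : ι → GaugeField P 0 G → ℝ)
    (hF : ∀ i ∈ s, PosHalfSupported (F i)) : PosHalfSupported fun U => ∏ i ∈ s, F i U :=
  fun U V hUV => Finset.prod_congr rfl fun i hi => hF i hi U V hUV

/-- The weighted expectation of a non-negative observable is non-negative (`β ≥ 0`). [folklore] -/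
theorem expect_mul_prod_nonneg (P : Params) {β : ℝ} (hβ : 0 ≤ β) {w : ℝ → ℝ} (hw0 : ∀ t, 0 ≤ w t)
    {F : GaugeField P 0 (Matrix.specialUnitaryGroup (Fin N) ℂ) → ℝ} (hF0 : ∀ U, 0 ≤ F U) :
    0 ≤ Missing.expect (G := Matrix.specialUnitaryGroup (Fin N) ℂ) P β
      (fun U => F U * ∏ p : Plaq P 0, w (1 - reTr (GaugeField.plaqHol U p))) := by
  unfold Missing.expect
  refine div_nonneg (integral_nonneg fun U => mul_nonneg (mul_nonneg (hF0 U) (Finset.prod_nonneg fun p _ => hw0 _))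
    (Missing.boltzmann_pos P β U).le) (Missing.partitionFn_pos' P hβ).le

/-- **THE CHESSBOARD ESTIMATE FOR THE PLAQUETTE-WEIGHTED LEVEL-0 STATE OF RECORD** (Fröhlich–Israel–Lieb–Simon, site reflections in
every axis and every lattice hyperplane).  Let `w ≥ 0` be a bounded measurable one-plaquette weight with `⟨∏_p w(1 − Re tr U(∂p))⟩_{P,β} > 0`
(`β ≥ 0`) — e.g. Bałaban's all-plaquette small-field characteristic function — and `F : sites → observables` a family of NON-NEGATIVE bounded
measurable observables indexed by the sites of `T^{(0)}` (read: by the closed unit cubes `[c, c + 1]^d`) which is COVARIANT under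
translations (`F_c ∘ τ_a = F_{c+a}`), coordinate permutations (`F_c ∘ π = F_{π·c}`) and the time reflection (`F_c ∘ Θ' = F_{θ₀c}`,
`θ₀c = c[0 ↦ −1 − c₀]`), whose members at cubes of the closed positive-time half (`c₀ < N₀∕2`) are positive-half supported, and with
`⟨∏_c F_c · ∏_p w⟩ > 0`.  Then for every set `S` of sites

  `⟨∏_{c ∈ S} F_c · ∏_p w⟩ ∕ ⟨∏_p w⟩ ≤ (⟨∏_{c} F_c · ∏_p w⟩ ∕ ⟨∏_p w⟩)^{#S ∕ N₀^d}`

— the weighted (restricted, normalised) state's expectation of a partial product is controlled by the full product.  Proof: the tree's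
abstract chessboard on the even torus `(ℤ∕N₀)^d` (`Probability.LatticeModels.chessboard_le_rpow_even`, FILS Thm. 4.1 ∕ Friedli–Velenik
Thm. 10.11) for the set function `ψ(S) = ⟨∏_{S} F_c ∏w⟩∕⟨∏w⟩`; its reflection Cauchy–Schwarz hypothesis in the direction `μ` through the
hyperplanes `x_μ = k, k + N₀∕2` is §1's `expect_conj_pairing_sq_le` for `π = swap 0 μ`, `a = −k e_μ`, whose label action on cubes is
`cellReflect μ k` (`conjLabel_eq_cellReflect`) and which carries cubes of the `μ`-positive half to time-positive cubes (`conjLabel_time`).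
[folklore] -/
theorem chessboard_of_covariant (P : Params) {β : ℝ} (hβ : 0 ≤ β) {w : ℝ → ℝ} (hw0 : ∀ t, 0 ≤ w t) (hwm : Measurable w)
    (hwb : ∃ K : ℝ, ∀ t, w t ≤ K)
    (hW : 0 < Missing.expect (G := Matrix.specialUnitaryGroup (Fin N) ℂ) P β
      (fun U => ∏ p : Plaq P 0, w (1 - reTr (GaugeField.plaqHol U p))))
    (F : BlockIdx P.d (P.sitesPerDir 0) → GaugeField P 0 (Matrix.specialUnitaryGroup (Fin N) ℂ) → ℝ)
    (hFm : ∀ c, Measurable (F c)) (hF0 : ∀ c U, 0 ≤ F c U) (hFb : ∃ K : ℝ, ∀ c U, F c U ≤ K)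
    (hFtr : ∀ (a c : BlockIdx P.d (P.sitesPerDir 0)) (U : GaugeField P 0 (Matrix.specialUnitaryGroup (Fin N) ℂ)),
      F c (U.translate a) = F (c + a) U)
    (hFperm : ∀ (π : Equiv.Perm (Fin P.d)) (c : BlockIdx P.d (P.sitesPerDir 0)) (U : GaugeField P 0 (Matrix.specialUnitaryGroup (Fin N) ℂ)),
      F c (U.permute π) = F (Site.permute π c) U)
    (hFrefl : ∀ (c : BlockIdx P.d (P.sitesPerDir 0)) (U : GaugeField P 0 (Matrix.specialUnitaryGroup (Fin N) ℂ)),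
      F c U.negReflect = F (Function.update c 0 (-1 - c 0)) U)
    (hFpos : ∀ c : BlockIdx P.d (P.sitesPerDir 0), (c 0).val < P.sitesPerDir 0 / 2 → PosHalfSupported (F c))
    (hF1 : 0 < Missing.expect (G := Matrix.specialUnitaryGroup (Fin N) ℂ) P β
      (fun U => (∏ c, F c U) * ∏ p : Plaq P 0, w (1 - reTr (GaugeField.plaqHol U p))))
    (S : Finset (BlockIdx P.d (P.sitesPerDir 0))) :
    Missing.expect (G := Matrix.specialUnitaryGroup (Fin N) ℂ) P β
        (fun U => (∏ c ∈ S, F c U) * ∏ p : Plaq P 0, w (1 - reTr (GaugeField.plaqHol U p))) /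
      Missing.expect (G := Matrix.specialUnitaryGroup (Fin N) ℂ) P β
        (fun U => ∏ p : Plaq P 0, w (1 - reTr (GaugeField.plaqHol U p))) ≤
    (Missing.expect (G := Matrix.specialUnitaryGroup (Fin N) ℂ) P β
        (fun U => (∏ c, F c U) * ∏ p : Plaq P 0, w (1 - reTr (GaugeField.plaqHol U p))) /
      Missing.expect (G := Matrix.specialUnitaryGroup (Fin N) ℂ) P β
        (fun U => ∏ p : Plaq P 0, w (1 - reTr (GaugeField.plaqHol U p)))) ^
      ((S.card : ℝ) / (P.sitesPerDir 0 : ℝ) ^ P.d) := by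
  classical
  obtain ⟨K, hK⟩ := hFb
  -- the weight, the set function `ψ`
  set W : GaugeField P 0 (Matrix.specialUnitaryGroup (Fin N) ℂ) → ℝ :=
    fun U => ∏ p : Plaq P 0, w (1 - reTr (GaugeField.plaqHol U p)) with hW_def
  set ψ : Finset (BlockIdx P.d (P.sitesPerDir 0)) → ℝ := fun T =>
    Missing.expect (G := Matrix.specialUnitaryGroup (Fin N) ℂ) P β (fun U => (∏ c ∈ T, F c U) * W U) /
      Missing.expect (G := Matrix.specialUnitaryGroup (Fin N) ℂ) P β W with hψ_def
  have hψ0 : ∀ T, 0 ≤ ψ T := fun T =>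
    div_nonneg (expect_mul_prod_nonneg P hβ hw0 fun U => Finset.prod_nonneg fun c _ => hF0 c U) hW.le
  have hψempty : ψ ∅ ≤ 1 := by
    simp only [hψ_def, Finset.prod_empty, one_mul]
    exact (div_self hW.ne').le
  have hψuniv : 0 < ψ Finset.univ := div_pos hF1 hW
  -- measurability and bounds of the partial products
  have hPm : ∀ T : Finset (BlockIdx P.d (P.sitesPerDir 0)),
      Measurable fun U : GaugeField P 0 (Matrix.specialUnitaryGroup (Fin N) ℂ) => ∏ c ∈ T, F c U := fun T =>
    Finset.measurable_prod _ fun c _ => hFm c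
  have hPb : ∀ T : Finset (BlockIdx P.d (P.sitesPerDir 0)),
      ∃ C : ℝ, ∀ U : GaugeField P 0 (Matrix.specialUnitaryGroup (Fin N) ℂ), |∏ c ∈ T, F c U| ≤ C := fun T =>
    ⟨K ^ T.card, fun U => by
      rw [Finset.abs_prod, ← Finset.prod_const]
      exact Finset.prod_le_prod (fun c _ => abs_nonneg _) fun c _ => by rw [abs_of_nonneg (hF0 c U)]; exact hK c U⟩
  have hL : Even (P.sitesPerDir 0) := even_sitesPerDir P 0
  -- the reflection Cauchy–Schwarz hypothesis of the abstract chessboard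
  have hcs : ∀ (μ : Fin P.d) (k : ZMod (P.sitesPerDir 0)) (T : Finset (BlockIdx P.d (P.sitesPerDir 0))),
      ψ T ^ 2 ≤ ψ (symP μ k T) * ψ (symM μ k T) := by
    intro μ k T
    -- the conjugate reflection `R` of the axis `μ` through `x_μ = k`: `π = swap 0 μ`, `a = −k e_μ`
    set a : BlockIdx P.d (P.sitesPerDir 0) := fun ν => if ν = μ then -k else 0 with ha_def
    have ha : ∀ ν, a ν = if ν = μ then -k else 0 := fun ν => rfl
    set HP := halfPlus (P.sitesPerDir 0) μ k with hHP
    set HM := halfMinus (P.sitesPerDir 0) μ k with hHM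
    -- its label action on the family is `cellReflect μ k`
    have hFR : ∀ (c : BlockIdx P.d (P.sitesPerDir 0)) (U : GaugeField P 0 (Matrix.specialUnitaryGroup (Fin N) ℂ)),
        F c (((((U.translate (-a)).permute (Equiv.swap 0 μ)⁻¹).negReflect).permute (Equiv.swap 0 μ)).translate a) = F (cellReflect μ k c) U := by
      intro c U
      rw [hFtr, hFperm, hFrefl, hFperm, hFtr, conjLabel_eq_cellReflect P μ k c a ha]
    -- members at cubes of the `μ`-positive half have positive-half-supported pull-backs along `σ'`
    have hposT : ∀ T' : Finset (BlockIdx P.d (P.sitesPerDir 0)), T' ⊆ HP →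
        PosHalfSupported fun V : GaugeField P 0 (Matrix.specialUnitaryGroup (Fin N) ℂ) =>
          ∏ c ∈ T', F c ((V.permute (Equiv.swap 0 μ)).translate a) := by
      intro T' hT'
      refine posHalfSupported_finsetProd T' _ fun c hc => ?_
      have hlab : ∀ V : GaugeField P 0 (Matrix.specialUnitaryGroup (Fin N) ℂ),
          F c ((V.permute (Equiv.swap 0 μ)).translate a) = F (Site.permute (Equiv.swap 0 μ) (c + a)) V := fun V => by
        rw [hFtr, hFperm]
      simp_rw [hlab]
      refine hFpos _ ?_
      rw [conjLabel_time P μ k c a ha]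
      exact mem_halfPlus.1 (hT' hc)
    -- geometry of the two halves
    have hdisjT : Disjoint (T ∩ HM) (T ∩ HP) := Finset.disjoint_left.2 fun c hcm hcp =>
      Finset.disjoint_left.1 (disjoint_halfPlus_halfMinus μ k) (Finset.mem_inter.1 hcp).2 (Finset.mem_inter.1 hcm).2
    have hTsplit : ∀ U : GaugeField P 0 (Matrix.specialUnitaryGroup (Fin N) ℂ),
        ∏ c ∈ T, F c U = (∏ c ∈ T ∩ HM, F c U) * ∏ c ∈ T ∩ HP, F c U := by
      intro U
      rw [← Finset.prod_union hdisjT]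
      congr 1
      ext c
      simp only [Finset.mem_union, Finset.mem_inter]
      constructor
      · intro hc
        rcases mem_halfPlus_or_mem_halfMinus μ k c with h | h
        · exact Or.inr ⟨hc, h⟩
        · exact Or.inl ⟨hc, h⟩
      · rintro (⟨hc, -⟩ | ⟨hc, -⟩) <;> exact hc
    have hMimg : (T ∩ HM).image (cellReflect μ k) ⊆ HP := by
      intro c hc
      obtain ⟨c', hc', rfl⟩ := Finset.mem_image.1 hc
      exact cellReflect_mem_halfPlus hL (Finset.mem_inter.1 hc').2
    have hPsub : T ∩ HP ⊆ HP := fun c hc => (Finset.mem_inter.1 hc).2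
    have hdisjM : Disjoint (T ∩ HM) ((T ∩ HM).image (cellReflect μ k)) := Finset.disjoint_left.2 fun c hcm hcp =>
      Finset.disjoint_left.1 (disjoint_halfPlus_halfMinus μ k) (hMimg hcp) (Finset.mem_inter.1 hcm).2
    have hdisjP : Disjoint (T ∩ HP) ((T ∩ HP).image (cellReflect μ k)) := Finset.disjoint_left.2 fun c hcp hcm => by
      obtain ⟨c', hc', rfl⟩ := Finset.mem_image.1 hcm
      exact Finset.disjoint_left.1 (disjoint_halfPlus_halfMinus μ k) (hPsub hcp) (cellReflect_mem_halfMinus hL (hPsub hc'))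
    -- `A ∘ R = ∏_{T ∩ H₋} F` for `A = ∏_{θ(T ∩ H₋)} F`, and `B ∘ R = ∏_{θ(T ∩ H₊)} F` for `B = ∏_{T ∩ H₊} F`
    have hAR : ∀ U : GaugeField P 0 (Matrix.specialUnitaryGroup (Fin N) ℂ),
        ∏ c ∈ (T ∩ HM).image (cellReflect μ k), F c (((((U.translate (-a)).permute (Equiv.swap 0 μ)⁻¹).negReflect).permute (Equiv.swap 0 μ)).translate a) = ∏ c ∈ T ∩ HM, F c U := by
      intro U
      rw [Finset.prod_image fun c _ c' _ h => (cellReflect μ k).injective h]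
      exact Finset.prod_congr rfl fun c _ => by rw [hFR, cellReflect_cellReflect]
    have hBR : ∀ U : GaugeField P 0 (Matrix.specialUnitaryGroup (Fin N) ℂ),
        ∏ c ∈ T ∩ HP, F c (((((U.translate (-a)).permute (Equiv.swap 0 μ)⁻¹).negReflect).permute (Equiv.swap 0 μ)).translate a) = ∏ c ∈ (T ∩ HP).image (cellReflect μ k), F c U := by
      intro U
      rw [Finset.prod_image fun c _ c' _ h => (cellReflect μ k).injective h]
      exact Finset.prod_congr rfl fun c _ => hFR c U
    -- Cauchy–Schwarz for the conjugate reflection, and the identification of the three pairings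
    have hCS := expect_conj_pairing_sq_le (N := N) P hβ (Equiv.swap 0 μ) a hw0 hwm hwb (hPm ((T ∩ HM).image (cellReflect μ k)))
      (hPb _) (hposT _ hMimg) (hPm (T ∩ HP)) (hPb _) (hposT _ hPsub)
    have e1 : (fun U => (∏ c ∈ (T ∩ HM).image (cellReflect μ k), F c (((((U.translate (-a)).permute (Equiv.swap 0 μ)⁻¹).negReflect).permute (Equiv.swap 0 μ)).translate a)) * (∏ c ∈ T ∩ HP, F c U) * W U) =
        fun U => (∏ c ∈ T, F c U) * W U := by
      funext U; rw [hAR, hTsplit]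
    have e2 : (fun U => (∏ c ∈ (T ∩ HM).image (cellReflect μ k), F c (((((U.translate (-a)).permute (Equiv.swap 0 μ)⁻¹).negReflect).permute (Equiv.swap 0 μ)).translate a)) *
          (∏ c ∈ (T ∩ HM).image (cellReflect μ k), F c U) * W U) = fun U => (∏ c ∈ symM μ k T, F c U) * W U := by
      funext U
      show _ = (∏ c ∈ T ∩ HM ∪ (T ∩ HM).image (cellReflect μ k), F c U) * W U
      rw [hAR, Finset.prod_union hdisjM]
    have e3 : (fun U => (∏ c ∈ T ∩ HP, F c (((((U.translate (-a)).permute (Equiv.swap 0 μ)⁻¹).negReflect).permute (Equiv.swap 0 μ)).translate a)) * (∏ c ∈ T ∩ HP, F c U) * W U) =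
        fun U => (∏ c ∈ symP μ k T, F c U) * W U := by
      funext U
      show _ = (∏ c ∈ T ∩ HP ∪ (T ∩ HP).image (cellReflect μ k), F c U) * W U
      rw [hBR, Finset.prod_union hdisjP, mul_comm (∏ c ∈ (T ∩ HP).image (cellReflect μ k), F c U)]
    have hCS' : Missing.expect (G := Matrix.specialUnitaryGroup (Fin N) ℂ) P β (fun U => (∏ c ∈ T, F c U) * W U) ^ 2 ≤
        Missing.expect (G := Matrix.specialUnitaryGroup (Fin N) ℂ) P β (fun U => (∏ c ∈ symP μ k T, F c U) * W U) *
          Missing.expect (G := Matrix.specialUnitaryGroup (Fin N) ℂ) P β (fun U => (∏ c ∈ symM μ k T, F c U) * W U) := by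
      have h : Missing.expect (G := Matrix.specialUnitaryGroup (Fin N) ℂ) P β
            (fun U => (∏ c ∈ (T ∩ HM).image (cellReflect μ k), F c (((((U.translate (-a)).permute (Equiv.swap 0 μ)⁻¹).negReflect).permute (Equiv.swap 0 μ)).translate a)) * (∏ c ∈ T ∩ HP, F c U) * W U) ^ 2 ≤
          Missing.expect (G := Matrix.specialUnitaryGroup (Fin N) ℂ) P β
              (fun U => (∏ c ∈ (T ∩ HM).image (cellReflect μ k), F c (((((U.translate (-a)).permute (Equiv.swap 0 μ)⁻¹).negReflect).permute (Equiv.swap 0 μ)).translate a)) *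
                (∏ c ∈ (T ∩ HM).image (cellReflect μ k), F c U) * W U) *
            Missing.expect (G := Matrix.specialUnitaryGroup (Fin N) ℂ) P β
              (fun U => (∏ c ∈ T ∩ HP, F c (((((U.translate (-a)).permute (Equiv.swap 0 μ)⁻¹).negReflect).permute (Equiv.swap 0 μ)).translate a)) * (∏ c ∈ T ∩ HP, F c U) * W U) := hCS
      rw [e1, e2, e3] at h
      exact h.trans_eq (mul_comm _ _)
    -- divide by `⟨W⟩²`
    show (_ / _) ^ 2 ≤ (_ / _) * (_ / _)
    rw [div_pow, div_mul_div_comm, ← sq]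
    exact div_le_div_of_nonneg_right hCS' (sq_nonneg _)
  -- the abstract chessboard on the even torus `(ℤ∕N₀)^d`
  have h := chessboard_le_rpow_even (d := P.d) (N := P.sitesPerDir 0) hL (ψ := ψ) hψ0 hψempty hψuniv hcs S
  simp only [hψ_def] at h
  exact h

end Chessboard

end Summit.QuantumFields.YangMills.BalabanUVNodes.N20LCSRestrictedChessboard

end
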